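import Summits.BirchSwinnertonDyer.BirchSwinnertonDyer.Theorems.BiquadraticEisensteinDescentHeegnerTwistCouplingInSupplySymbolicMonskyPatternFree
import HarnessLib

set_option linter.dupNamespace false -- `Summit.BirchSwinnertonDyer.BirchSwinnertonDyer.Theorems.…` (summit = sub)
set_option autoImplicit false

/-!
# Crux `HeegnerTwistCouplingInSupply` (stmt-BirchSwinnertonDyer-21381) — PATTERN-FREE CRITERION, part 2 (the symbolic matrices):
# row structure of `monskyOddS` / `monskyEvenS`, agreement off the auxiliary block, and the ★ criterion theorems at every `k`, `t`

Route `BiquadraticEisensteinDescent` (cell `pub/bsd-wall`, width seat `bsd-wall-cm-bed-w3` g20; `--supports` 21381, helper). Proof file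
(2/3) of the pattern-free layer. §3: the rows of Monsky's symbolic matrices in DIFFERENCE FORM
`(M z)_(inl i) = ∑_j bz(neg i j)(z_(inl j) + z_(inl i)) + …` (`monskyOddS_mulVec_inl/inr`, `monskyEvenS_mulVec_inl/inr`); reciprocity is
pattern-free (`neg_xor_neg`: `neg i j ⊕ neg j i = [P_i ≡ P_j ≡ 3 (4)]`); for data agreeing off `Q × Q` (`AgreeOffAux`): (i) rows outside
`Q` agree, (ii) the matrices agree on `Q`-constant vectors, (iii) the `Q`-row sums agree — the `Q × Q` double sum of the SYMMETRIC
difference kernel against the symmetric weights `z_i + z_j` vanishes in characteristic `2` (`sum_sum_symm_eq_zero`, `Finset.sum_involution`).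
§4 ★ `SymbData.det_monskyOddS_eq_one_of_pfCheckOdd` / `…Even…`: `d.pfCheckOdd Q = true → d.AgreeOffAux Q d' → det M_odd(d') = 1`.
§5 ★ `det_dataK_odd_of_pfRecipeOdd` / `…even…`: at general `k`, a recipe passing `pfRecipeOdd base aux` (ONE `decide`, no mutual symbol)
has the Heegner check and `det M_odd(dataK base aux pat) = 1` for EVERY mutual pattern `pat`.

HONEST FRAMING: engine theorems; which configurations OWN a pattern-free family is a separate question (memo PATTERN-FREE-MECHANISM-w3g20:
generically `t = s*/2 + 1` auxiliary primes, `s*` = corank of Monsky's matrix of the base twisted by the Heegner-forced virtual prime;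
all configurations `k ≤ 4` up to a thin exceptional class needing one more prime). The crux (C⁺), its stubs and BSD untouched; nothing
closed. THEOREMS ONLY. Reference: [HeathBrown1994] appendix (Monsky), typescript pp. 39–41.
-/

namespace Summit.BirchSwinnertonDyer.BirchSwinnertonDyer.Theorems.SymbolicMonsky

open Matrix
/-! ## §3 Row structure of the symbolic Monsky matrices -/

namespace SymbData

open Matrix

variable {k : ℕ} (d : SymbData k)

/-- **Reciprocity bookkeeping is pattern-free**: for `i ≠ j`, `neg i j XOR neg j i = [P_i ≡ P_j ≡ 3 (4)]`. -/
theorem neg_xor_neg {i j : Fin k} (hij : i ≠ j) :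
    xor (d.neg i j) (d.neg j i) = (negNegOne (d.cls i) && negNegOne (d.cls j)) := by
  rcases lt_or_gt_of_ne hij with h | h
  · have h' : ¬ j < i := not_lt_of_gt h
    simp only [SymbData.neg, h, h', if_true, if_false]
    cases d.up i j <;> simp [Bool.and_comm]
  · have h' : ¬ i < j := not_lt_of_gt h
    simp only [SymbData.neg, h, h', if_true, if_false]
    cases d.up j i <;> simp

/-- In `𝔽₂`: `bz (neg j i) = bz (neg i j) + bz [P_i ≡ P_j ≡ 3 (4)]` for `i ≠ j`. -/
theorem bz_neg_swap {i j : Fin k} (hij : i ≠ j) :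
    bz (d.neg j i) = bz (d.neg i j) + bz (negNegOne (d.cls i) && negNegOne (d.cls j)) := by
  rw [← d.neg_xor_neg hij]
  cases d.neg i j <;> cases d.neg j i <;> decide

/-- The diagonal of Monsky's `A` in `𝔽₂`: `bz (aEntry i i) = ∑_{j ≠ i} bz (neg i j)`. -/
theorem bz_aEntry_diag (i : Fin k) :
    bz (d.aEntry i i) = ∑ j : Fin k, if j = i then 0 else bz (d.neg i j) := by
  have h1 : d.aEntry i i = xorFold ((List.finRange k).filter (fun l => l ≠ i)) (d.neg i) := by
    simp [SymbData.aEntry]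
  rw [h1, xorFold_filter, ← sum_univ_bz]
  refine Finset.sum_congr rfl fun j _ => ?_
  by_cases h : j = i
  · simp [h, bz]
  · simp [h]

/-- Off the diagonal `aEntry i j = neg i j`. -/
theorem aEntry_off {i j : Fin k} (h : i ≠ j) : d.aEntry i j = d.neg i j := by
  simp [SymbData.aEntry, h]

/-- Generic row identity: `∑_j bz(aEntry i j) z_j = ∑_j bz(neg i j) (z_j + z_i)` (the `j = i` term of the right side vanishes in
`𝔽₂`; the diagonal `aEntry i i` is the row parity). -/
theorem sum_bz_aEntry_mul (i : Fin k) (w : Fin k → ZMod 2) :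
    (∑ j : Fin k, bz (d.aEntry i j) * w j) = ∑ j : Fin k, bz (d.neg i j) * (w j + w i) := by
  classical
  have h1 : ∀ j : Fin k, bz (d.aEntry i j) * w j =
      (if j = i then 0 else bz (d.neg i j) * w j) + (if j = i then bz (d.aEntry i i) * w i else 0) := by
    intro j
    by_cases h : j = i
    · subst h; simp
    · rw [d.aEntry_off (Ne.symm h)]; simp [h]
  rw [Finset.sum_congr rfl fun j _ => h1 j, Finset.sum_add_distrib, Finset.sum_ite_eq' Finset.univ i,
    if_pos (Finset.mem_univ i), d.bz_aEntry_diag, Finset.sum_mul, ← Finset.sum_add_distrib]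
  refine Finset.sum_congr rfl fun j _ => ?_
  by_cases h : j = i
  · subst h; simp [zmod_two_add_self]
  · simp [h, mul_add]

/-- Transposed row identity (even matrix, half one): `∑_j bz(aEntry j i) z_j = ∑_j bz(neg i j)(z_j + z_i) + ∑_{j ≠ i} bz[3,3] z_j`. -/
theorem sum_bz_aEntry_transpose_mul (i : Fin k) (w : Fin k → ZMod 2) :
    (∑ j : Fin k, bz (d.aEntry j i) * w j) = ∑ j : Fin k, (bz (d.neg i j) * (w j + w i) +
      (if j = i then 0 else bz (negNegOne (d.cls i) && negNegOne (d.cls j)) * w j)) := by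
  classical
  have h1 : ∀ j : Fin k, bz (d.aEntry j i) * w j =
      (if j = i then 0 else bz (d.neg i j) * w j) + (if j = i then bz (d.aEntry i i) * w i else 0) +
      (if j = i then 0 else bz (negNegOne (d.cls i) && negNegOne (d.cls j)) * w j) := by
    intro j
    by_cases h : j = i
    · subst h; simp
    · rw [d.aEntry_off h, d.bz_neg_swap (Ne.symm h)]; simp [h, add_mul]
  rw [Finset.sum_congr rfl fun j _ => h1 j, Finset.sum_add_distrib, Finset.sum_add_distrib,
    Finset.sum_ite_eq' Finset.univ i, if_pos (Finset.mem_univ i), d.bz_aEntry_diag, Finset.sum_mul,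
    ← Finset.sum_add_distrib, ← Finset.sum_add_distrib]
  refine Finset.sum_congr rfl fun j _ => ?_
  by_cases h : j = i
  · subst h; simp [zmod_two_add_self]
  · simp [h, mul_add]

/-- **Row structure, odd matrix, half one**: `(M_odd z)_{inl i} = ∑_j bz(neg i j)(z_{inl j} + z_{inl i}) + bz[(2/P_i)=−1](z_{inl i} + z_{inr i})`. -/
theorem monskyOddS_mulVec_inl (z : Fin k ⊕ Fin k → ZMod 2) (i : Fin k) :
    (d.monskyOddS *ᵥ z) (Sum.inl i) = (∑ j : Fin k, bz (d.neg i j) * (z (Sum.inl j) + z (Sum.inl i))) +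
      bz (negTwo (d.cls i)) * (z (Sum.inl i) + z (Sum.inr i)) := by
  classical
  rw [Matrix.mulVec, dotProduct, Fintype.sum_sum_type]
  simp only [SymbData.monskyOddS, Matrix.of_apply, SymbData.entryOdd, bz_xor_add, bz_decide_and, add_mul]
  rw [Finset.sum_add_distrib, d.sum_bz_aEntry_mul i (fun j => z (Sum.inl j))]
  simp only [ite_mul, zero_mul, Finset.sum_ite_eq, Finset.mem_univ, if_true, mul_add]
  ring

/-- **Row structure, odd matrix, half two**: `(M_odd z)_{inr i} = bz[(2/P_i)=−1] z_{inl i} + ∑_j bz(neg i j)(z_{inr j} + z_{inr i}) + bz[(−2/P_i)=−1] z_{inr i}`. -/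
theorem monskyOddS_mulVec_inr (z : Fin k ⊕ Fin k → ZMod 2) (i : Fin k) :
    (d.monskyOddS *ᵥ z) (Sum.inr i) = bz (negTwo (d.cls i)) * z (Sum.inl i) +
      (∑ j : Fin k, bz (d.neg i j) * (z (Sum.inr j) + z (Sum.inr i))) + bz (negNegTwo (d.cls i)) * z (Sum.inr i) := by
  classical
  rw [Matrix.mulVec, dotProduct, Fintype.sum_sum_type]
  simp only [SymbData.monskyOddS, Matrix.of_apply, SymbData.entryOdd, bz_xor_add, bz_decide_and, add_mul]
  rw [Finset.sum_add_distrib, d.sum_bz_aEntry_mul i (fun j => z (Sum.inr j))]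
  simp only [ite_mul, zero_mul, Finset.sum_ite_eq, Finset.mem_univ, if_true]
  ring

/-- **Row structure, even matrix, half one** (transposed `A`, plus `D₂`, and `D₋₁` on the other half). -/
theorem monskyEvenS_mulVec_inl (z : Fin k ⊕ Fin k → ZMod 2) (i : Fin k) :
    (d.monskyEvenS *ᵥ z) (Sum.inl i) = (∑ j : Fin k, (bz (d.neg i j) * (z (Sum.inl j) + z (Sum.inl i)) +
      (if j = i then 0 else bz (negNegOne (d.cls i) && negNegOne (d.cls j)) * z (Sum.inl j)))) +
      bz (negTwo (d.cls i)) * z (Sum.inl i) + bz (negNegOne (d.cls i)) * z (Sum.inr i) := by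
  classical
  rw [Matrix.mulVec, dotProduct, Fintype.sum_sum_type]
  simp only [SymbData.monskyEvenS, Matrix.of_apply, SymbData.entryEven, bz_xor_add, bz_decide_and, add_mul]
  rw [Finset.sum_add_distrib, d.sum_bz_aEntry_transpose_mul i (fun j => z (Sum.inl j))]
  simp only [ite_mul, zero_mul, Finset.sum_ite_eq, Finset.mem_univ, if_true]

/-- **Row structure, even matrix, half two**. -/
theorem monskyEvenS_mulVec_inr (z : Fin k ⊕ Fin k → ZMod 2) (i : Fin k) :
    (d.monskyEvenS *ᵥ z) (Sum.inr i) = bz (negTwo (d.cls i)) * z (Sum.inl i) +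
      (∑ j : Fin k, bz (d.neg i j) * (z (Sum.inr j) + z (Sum.inr i))) + bz (negTwo (d.cls i)) * z (Sum.inr i) := by
  classical
  rw [Matrix.mulVec, dotProduct, Fintype.sum_sum_type]
  simp only [SymbData.monskyEvenS, Matrix.of_apply, SymbData.entryEven, bz_xor_add, bz_decide_and, add_mul]
  rw [Finset.sum_add_distrib, d.sum_bz_aEntry_mul i (fun j => z (Sum.inr j))]
  simp only [ite_mul, zero_mul, Finset.sum_ite_eq, Finset.mem_univ, if_true]
  ring

/-! ### Agreement off the auxiliary block -/

variable {d} {d' : SymbData k} {Q : Fin k → Bool}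

/-- Classes agree. -/
theorem AgreeOffAux.cls_eq' (h : d.AgreeOffAux Q d') (i : Fin k) : d'.cls i = d.cls i := h.cls_eq i

/-- Completed symbols agree off `Q × Q`. -/
theorem AgreeOffAux.neg_eq (h : d.AgreeOffAux Q d') {i j : Fin k} (hij : Q i = false ∨ Q j = false) :
    d'.neg i j = d.neg i j := by
  unfold SymbData.neg
  rw [h.up_eq i j hij, h.up_eq j i (hij.symm), h.cls_eq i, h.cls_eq j]

/-- The difference of completed symbols `g i j := bz(neg' i j) + bz(neg i j)` is SYMMETRIC (reciprocity is pattern-free). -/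
theorem AgreeOffAux.bz_neg_add_symm (h : d.AgreeOffAux Q d') (i j : Fin k) :
    bz (d'.neg i j) + bz (d.neg i j) = bz (d'.neg j i) + bz (d.neg j i) := by
  by_cases hij : i = j
  · subst hij; rfl
  · rw [d.bz_neg_swap hij, d'.bz_neg_swap hij, h.cls_eq i, h.cls_eq j]
    generalize bz (d'.neg i j) = a; generalize bz (d.neg i j) = b
    generalize bz (negNegOne (d.cls i) && negNegOne (d.cls j)) = c
    fin_cases a <;> fin_cases b <;> fin_cases c <;> decide

/-- `g i j = 0` unless both `i, j ∈ Q`. -/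
theorem AgreeOffAux.bz_neg_add_eq_zero (h : d.AgreeOffAux Q d') {i j : Fin k} (hij : Q i = false ∨ Q j = false) :
    bz (d'.neg i j) + bz (d.neg i j) = 0 := by
  rw [h.neg_eq hij, zmod_two_add_self]

/-- **The symbol sums differ by a `Q × Q` double sum**: for every `i` and every weight `w`,
`∑_j bz(neg' i j) w j = ∑_j bz(neg i j) w j + ∑_{j ∈ Q} g i j · w j`, with the extra sum zero unless `i ∈ Q`. -/
theorem AgreeOffAux.sum_neg_eq (h : d.AgreeOffAux Q d') (i : Fin k) (w : Fin k → ZMod 2) :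
    (∑ j : Fin k, bz (d'.neg i j) * w j) = (∑ j : Fin k, bz (d.neg i j) * w j) +
      ∑ j ∈ Finset.univ.filter (fun j => Q j = true), (bz (d'.neg i j) + bz (d.neg i j)) * w j := by
  classical
  rw [Finset.sum_filter, ← Finset.sum_add_distrib]
  refine Finset.sum_congr rfl fun j _ => ?_
  by_cases hq : Q j = true
  · rw [if_pos hq]
    generalize bz (d'.neg i j) = a; generalize bz (d.neg i j) = b; generalize w j = x
    fin_cases a <;> fin_cases b <;> fin_cases x <;> decide
  · have hq' : Q j = false := by simpa using hq
    rw [if_neg hq, add_zero, h.neg_eq (Or.inr hq')]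

/-- The `Q × Q` double sum of a symmetric `𝔽₂`-kernel against the symmetric weights `z_j + z_i` vanishes. -/
theorem sum_sum_symm_eq_zero (S : Finset (Fin k)) (g : Fin k → Fin k → ZMod 2) (hg : ∀ i j, g i j = g j i)
    (v : Fin k → ZMod 2) : (∑ i ∈ S, ∑ j ∈ S, g i j * (v j + v i)) = 0 := by
  classical
  rw [← Finset.sum_product']
  refine Finset.sum_involution (fun p _ => (p.2, p.1)) ?_ ?_ ?_ ?_
  · intro p _
    rw [hg p.2 p.1, add_comm (v p.1) (v p.2)]
    exact zmod_two_add_self _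
  · intro p _ hne heq
    apply hne
    have h1 : p.1 = p.2 := (congrArg Prod.fst heq).symm
    rw [h1, zmod_two_add_self, mul_zero]
  · intro p hp
    simp only [Finset.mem_product] at hp ⊢
    exact ⟨hp.2, hp.1⟩
  · intro p _; rfl

/-- (i) odd: rows outside `Q` agree. -/
theorem AgreeOffAux.monskyOddS_mulVec_eq_of_not_mem (h : d.AgreeOffAux Q d') (z : Fin k ⊕ Fin k → ZMod 2) (i : Fin k)
    (hi : Q i = false) :
    (d'.monskyOddS *ᵥ z) (Sum.inl i) = (d.monskyOddS *ᵥ z) (Sum.inl i) ∧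
      (d'.monskyOddS *ᵥ z) (Sum.inr i) = (d.monskyOddS *ᵥ z) (Sum.inr i) := by
  have hn : ∀ j, d'.neg i j = d.neg i j := fun j => h.neg_eq (Or.inl hi)
  constructor
  · rw [d'.monskyOddS_mulVec_inl, d.monskyOddS_mulVec_inl, h.cls_eq]
    simp only [hn]
  · rw [d'.monskyOddS_mulVec_inr, d.monskyOddS_mulVec_inr, h.cls_eq]
    simp only [hn]

/-- (i) even: rows outside `Q` agree. -/
theorem AgreeOffAux.monskyEvenS_mulVec_eq_of_not_mem (h : d.AgreeOffAux Q d') (z : Fin k ⊕ Fin k → ZMod 2) (i : Fin k)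
    (hi : Q i = false) :
    (d'.monskyEvenS *ᵥ z) (Sum.inl i) = (d.monskyEvenS *ᵥ z) (Sum.inl i) ∧
      (d'.monskyEvenS *ᵥ z) (Sum.inr i) = (d.monskyEvenS *ᵥ z) (Sum.inr i) := by
  have hn : ∀ j, d'.neg i j = d.neg i j := fun j => h.neg_eq (Or.inl hi)
  have hc : ∀ j, d'.cls j = d.cls j := h.cls_eq
  constructor
  · rw [d'.monskyEvenS_mulVec_inl, d.monskyEvenS_mulVec_inl]
    simp only [hn, hc]
  · rw [d'.monskyEvenS_mulVec_inr, d.monskyEvenS_mulVec_inr, hc]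
    simp only [hn]

/-- Termwise: on a `Q`-constant vector the symbol sums agree. -/
theorem AgreeOffAux.sum_neg_mul_eq_of_const (h : d.AgreeOffAux Q d') (i : Fin k) (v : Fin k → ZMod 2)
    (hv : ∀ i j, Q i = true → Q j = true → v i = v j) :
    (∑ j : Fin k, bz (d'.neg i j) * (v j + v i)) = ∑ j : Fin k, bz (d.neg i j) * (v j + v i) := by
  refine Finset.sum_congr rfl fun j _ => ?_
  by_cases hq : Q i = true ∧ Q j = true
  · rw [hv j i hq.2 hq.1, zmod_two_add_self, mul_zero, mul_zero]
  · have : Q i = false ∨ Q j = false := by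
      by_cases hi : Q i = true
      · right; simpa using fun hj => hq ⟨hi, hj⟩
      · left; simpa using hi
    rw [h.neg_eq this]

/-- (ii) odd: on `Q`-constant vectors the matrices agree. -/
theorem AgreeOffAux.monskyOddS_mulVec_eq_of_const (h : d.AgreeOffAux Q d') (z : Fin k ⊕ Fin k → ZMod 2)
    (hz : ∀ i j, Q i = true → Q j = true → z (Sum.inl i) = z (Sum.inl j) ∧ z (Sum.inr i) = z (Sum.inr j)) :
    d'.monskyOddS *ᵥ z = d.monskyOddS *ᵥ z := by
  funext x
  rcases x with i | i
  · rw [d'.monskyOddS_mulVec_inl, d.monskyOddS_mulVec_inl, h.cls_eq,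
      h.sum_neg_mul_eq_of_const i (fun j => z (Sum.inl j)) (fun i j hi hj => (hz i j hi hj).1)]
  · rw [d'.monskyOddS_mulVec_inr, d.monskyOddS_mulVec_inr, h.cls_eq,
      h.sum_neg_mul_eq_of_const i (fun j => z (Sum.inr j)) (fun i j hi hj => (hz i j hi hj).2)]

/-- (ii) even: on `Q`-constant vectors the matrices agree. -/
theorem AgreeOffAux.monskyEvenS_mulVec_eq_of_const (h : d.AgreeOffAux Q d') (z : Fin k ⊕ Fin k → ZMod 2)
    (hz : ∀ i j, Q i = true → Q j = true → z (Sum.inl i) = z (Sum.inl j) ∧ z (Sum.inr i) = z (Sum.inr j)) :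
    d'.monskyEvenS *ᵥ z = d.monskyEvenS *ᵥ z := by
  have hc : ∀ j, d'.cls j = d.cls j := h.cls_eq
  funext x
  rcases x with i | i
  · rw [d'.monskyEvenS_mulVec_inl, d.monskyEvenS_mulVec_inl, Finset.sum_add_distrib, Finset.sum_add_distrib,
      h.sum_neg_mul_eq_of_const i (fun j => z (Sum.inl j)) (fun i j hi hj => (hz i j hi hj).1)]
    simp only [hc]
  · rw [d'.monskyEvenS_mulVec_inr, d.monskyEvenS_mulVec_inr, hc,
      h.sum_neg_mul_eq_of_const i (fun j => z (Sum.inr j)) (fun i j hi hj => (hz i j hi hj).2)]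

/-- (iii) the `Q`-row sums of the symbol part agree (the `Q × Q` double sum of the symmetric difference kernel vanishes). -/
theorem AgreeOffAux.sum_sum_neg_eq (h : d.AgreeOffAux Q d') (v : Fin k → ZMod 2) :
    (∑ i ∈ Finset.univ.filter (fun i => Q i = true), ∑ j : Fin k, bz (d'.neg i j) * (v j + v i)) =
      ∑ i ∈ Finset.univ.filter (fun i => Q i = true), ∑ j : Fin k, bz (d.neg i j) * (v j + v i) := by
  classical
  have step : ∀ i, (∑ j : Fin k, bz (d'.neg i j) * (v j + v i)) = (∑ j : Fin k, bz (d.neg i j) * (v j + v i)) +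
      ∑ j ∈ Finset.univ.filter (fun j => Q j = true), (bz (d'.neg i j) + bz (d.neg i j)) * (v j + v i) :=
    fun i => h.sum_neg_eq i (fun j => v j + v i)
  rw [Finset.sum_congr rfl fun i _ => step i, Finset.sum_add_distrib,
    sum_sum_symm_eq_zero _ (fun i j => bz (d'.neg i j) + bz (d.neg i j)) (fun i j => h.bz_neg_add_symm i j) v, add_zero]

/-- (iii) odd: the `Q`-row sums agree in each half. -/
theorem AgreeOffAux.sum_monskyOddS_mulVec_eq (h : d.AgreeOffAux Q d') (z : Fin k ⊕ Fin k → ZMod 2) :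
    (∑ i ∈ Finset.univ.filter (fun i => Q i = true), (d'.monskyOddS *ᵥ z) (Sum.inl i)) =
        (∑ i ∈ Finset.univ.filter (fun i => Q i = true), (d.monskyOddS *ᵥ z) (Sum.inl i)) ∧
      (∑ i ∈ Finset.univ.filter (fun i => Q i = true), (d'.monskyOddS *ᵥ z) (Sum.inr i)) =
        (∑ i ∈ Finset.univ.filter (fun i => Q i = true), (d.monskyOddS *ᵥ z) (Sum.inr i)) := by
  have hc : ∀ j, d'.cls j = d.cls j := h.cls_eq
  constructor
  · simp only [monskyOddS_mulVec_inl, Finset.sum_add_distrib, hc]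
    rw [h.sum_sum_neg_eq (fun j => z (Sum.inl j))]
  · simp only [monskyOddS_mulVec_inr, Finset.sum_add_distrib, hc]
    rw [h.sum_sum_neg_eq (fun j => z (Sum.inr j))]

/-- (iii) even: the `Q`-row sums agree in each half. -/
theorem AgreeOffAux.sum_monskyEvenS_mulVec_eq (h : d.AgreeOffAux Q d') (z : Fin k ⊕ Fin k → ZMod 2) :
    (∑ i ∈ Finset.univ.filter (fun i => Q i = true), (d'.monskyEvenS *ᵥ z) (Sum.inl i)) =
        (∑ i ∈ Finset.univ.filter (fun i => Q i = true), (d.monskyEvenS *ᵥ z) (Sum.inl i)) ∧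
      (∑ i ∈ Finset.univ.filter (fun i => Q i = true), (d'.monskyEvenS *ᵥ z) (Sum.inr i)) =
        (∑ i ∈ Finset.univ.filter (fun i => Q i = true), (d.monskyEvenS *ᵥ z) (Sum.inr i)) := by
  have hc : ∀ j, d'.cls j = d.cls j := h.cls_eq
  constructor
  · simp only [monskyEvenS_mulVec_inl, Finset.sum_add_distrib, hc]
    rw [h.sum_sum_neg_eq (fun j => z (Sum.inl j))]
  · simp only [monskyEvenS_mulVec_inr, Finset.sum_add_distrib, hc]
    rw [h.sum_sum_neg_eq (fun j => z (Sum.inr j))]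

/-! ## §4 The criterion theorems -/

/-- ★ **PATTERN-FREE CRITERION, odd matrix.** If `d.pfCheckOdd Q` accepts, then EVERY symbol datum `d'` agreeing with `d` off
`Q × Q` — i.e. with arbitrary mutual symbols among the auxiliary primes — has `det M_odd(d') = 1` (`s = 0`).
[cite: HeathBrown1994SelmerCongruentII, Appendix (Monsky), typescript p. 39 L27–L33] -/
theorem det_monskyOddS_eq_one_of_pfCheckOdd (hpf : d.pfCheckOdd Q = true) (h : d.AgreeOffAux Q d') :
    d'.monskyOddS.det = 1 := by
  simp only [SymbData.pfCheckOdd, Bool.and_eq_true] at hpf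
  obtain ⟨hdet, hdiff⟩ := hpf
  exact det_eq_one_of_agree_off_block Q d.monskyOddS d'.monskyOddS
    (fun z i hi => h.monskyOddS_mulVec_eq_of_not_mem z i hi) (fun z hz => h.monskyOddS_mulVec_eq_of_const z hz)
    (fun z => h.sum_monskyOddS_mulVec_eq z) (d.det_monskyOddS_eq_one hdet)
    (fun z hz hs1 hs2 i j hi hj => qconst_of_diffCheckRows Q d.monskyOddS d.rowsOdd d.rowsOdd_length
      d.matOfRows_rowsOdd hdiff z hz hs1 hs2 i j hi hj)

/-- ★ **PATTERN-FREE CRITERION, even matrix.**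
[cite: HeathBrown1994SelmerCongruentII, Appendix (Monsky), typescript p. 41 L20–L36] -/
theorem det_monskyEvenS_eq_one_of_pfCheckEven (hpf : d.pfCheckEven Q = true) (h : d.AgreeOffAux Q d') :
    d'.monskyEvenS.det = 1 := by
  simp only [SymbData.pfCheckEven, Bool.and_eq_true] at hpf
  obtain ⟨hdet, hdiff⟩ := hpf
  exact det_eq_one_of_agree_off_block Q d.monskyEvenS d'.monskyEvenS
    (fun z i hi => h.monskyEvenS_mulVec_eq_of_not_mem z i hi) (fun z hz => h.monskyEvenS_mulVec_eq_of_const z hz)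
    (fun z => h.sum_monskyEvenS_mulVec_eq z) (d.det_monskyEvenS_eq_one hdet)
    (fun z hz hs1 hs2 i j hi hj => qconst_of_diffCheckRows Q d.monskyEvenS d.rowsEven d.rowsEven_length
      d.matOfRows_rowsEven hdiff z hz hs1 hs2 i j hi hj)

end SymbData

/-! ## §5 The sign-table game at general `k`: pattern-free recipes win for every mutual pattern -/

section GeneralK

variable {k : ℕ} (base : SymbData (k + 1)) (aux : List AuxCell)

/-- Two mutual patterns give symbol data agreeing off the auxiliary block. -/
theorem agreeOffAux_dataK (pat pat' : ℕ → ℕ → Bool) :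
    (dataK base aux pat).AgreeOffAux (auxQ k aux.length) (dataK base aux pat') := by
  refine ⟨fun _ => rfl, fun i j hij => ?_⟩
  simp only [auxQ, decide_eq_false_iff_not, not_le] at hij
  unfold dataK
  simp only
  rcases hij with hi | hj
  · simp [hi]
  · simp [hj]

/-- ★ **General-`k` pattern-free recipe, odd base**: if `pfRecipeOdd base aux` accepts, the Heegner check holds and
`det M_odd = 1` for EVERY mutual pattern of the auxiliary primes. -/
theorem det_dataK_odd_of_pfRecipeOdd (h : pfRecipeOdd base aux = true) (pat : ℕ → ℕ → Bool) :
    heegnerK base aux = true ∧ (dataK base aux pat).monskyOddS.det = 1 := by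
  simp only [pfRecipeOdd, Bool.and_eq_true] at h
  exact ⟨h.1, SymbData.det_monskyOddS_eq_one_of_pfCheckOdd h.2 (agreeOffAux_dataK base aux _ pat)⟩

/-- ★ **General-`k` pattern-free recipe, even base**. -/
theorem det_dataK_even_of_pfRecipeEven (h : pfRecipeEven base aux = true) (pat : ℕ → ℕ → Bool) :
    heegnerK base aux = true ∧ (dataK base aux pat).monskyEvenS.det = 1 := by
  simp only [pfRecipeEven, Bool.and_eq_true] at h
  exact ⟨h.1, SymbData.det_monskyEvenS_eq_one_of_pfCheckEven h.2 (agreeOffAux_dataK base aux _ pat)⟩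

end GeneralK

end Summit.BirchSwinnertonDyer.BirchSwinnertonDyer.Theorems.SymbolicMonsky
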